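import Summits.BirchSwinnertonDyer.BirchSwinnertonDyer.Theorems.KimAtThreeFineKatoKPortSatLog
import Summits.BirchSwinnertonDyer.BirchSwinnertonDyer.Theorems.KimAtThreeFineKatoKPortPadicCompat
import HarnessLib

/-!
# K-PORT glue (G1+G2+G4 combined): the saturated logarithm `Λ̃` is GALOIS-EQUIVARIANT and restricts
# on `ℚ_p`-points to n1011's `padicLog` on ALL of `E(ℚ_p)`
# (cell `bsd-addord`, seat w2-kport gen 0; `--supports stmt-BirchSwinnertonDyer-19560`, helper)

HONEST FRAMING. Route W2 (`route-BirchSwinnertonDyer-KimAtThreeKolyvagin`), crux 19560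
`KatoKuriharaPortThreeShared`, residual ⟨C1⟩ clause (C1.c) = SAT₀'s E-side (kim3 brief
KIM3-KPORT-BRIEF-g12 §3 (P2): additivity, EQUIVARIANCE, and `log|_{E(ℚ₃)} = padicLog`). The three
sibling files give `Λ̃ = satLog p K M` (`…KPortSatLog`: additive on `Ẽ₁(K) = satKernel`), the
equivariance of `Λ = BallEval.ptLog` on `E₁(K)` (`…KPortEquivariance`) and `Λ|_{E₁(ℚ_p)} = log_X ∘ z`
(`…KPortPadicCompat`). This file combines them. TOOL theorems only (no definition, no named fact, no
`sorry`); closes nothing by itself; nothing booked.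

## What is proved (`E = curveK p K M`, `X = M ⊗ ℚ_p`, `T_φ = Affine.Point.map φ`, `ι = T_{ℚ_p → K}`)

* §1 for an isometric `φ : K →ₐ[ℚ_[p]] K'`: `map_nsmul_mem_kernel_iff`, `map_mem_satKernel_iff` (`T_φ P ∈ Ẽ₁(K') ↔ P ∈ Ẽ₁(K)`),
  **`satLog_map`** (`Λ̃(T_φ P) = φ (Λ̃ P)` for EVERY `P ∈ E(K)`), `satLog_galois` (`σ ∈ Gal(K/ℚ_p)`, `K`
  algebraic), `sum_map_mem_satKernel`, **`satLog_sum_map`** (`Λ̃(∑ᵢ T_{φᵢ} P) = ∑ᵢ φᵢ (Λ̃ P)` on `Ẽ₁(K)` —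
  the shape `Λ̃(N_{K/ℚ₃} P) = Tr_{K/ℚ₃}(Λ̃ P)`).
* §2 `map_ofId_mem_satKernel` (every `ℚ_p`-point lands in `Ẽ₁(K)`: `[E(ℚ_p) : E⁽²⁾(ℚ_p)]` is finite),
  **`satLog_map_ofId`**: `Λ̃(ι P) = algebraMap (padicLog X P)` for EVERY `P ∈ E(ℚ_p)` — the compatibility
  "`log|_{E(ℚ₃)} =` n1011's `padicLog`" of the brief, on the nose.

References: J. H. Silverman, *The Arithmetic of Elliptic Curves*, 2nd ed. (2009), IV.6.4, VII.2.2, VII.6.3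
[SilvermanAEC2009]; kim3 brief HOME/kim3/KIM3-KPORT-BRIEF-g12.md §3 (P2).
-/

noncomputable section

-- the cell's Theorems namespace `Summit.BirchSwinnertonDyer.BirchSwinnertonDyer.…` repeats the summit name by design (D-0017)
set_option linter.dupNamespace false

open scoped Classical

namespace Summit.BirchSwinnertonDyer.BirchSwinnertonDyer.Theorems.KPort

open Summit.BirchSwinnertonDyer.Rank1Residual.Additive.BallEval
open Summit.BirchSwinnertonDyer.Rank1Residual.Additive.LocalLog
open Literature.NumberTheory.GaloisRepresentations.LubinTate (unitBall mem_unitBall_iff)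
open Literature.NumberTheory.EllipticCurves Literature.NumberTheory.EllipticCurves.FormalGroupChart
open WeierstrassCurve

variable {p : ℕ} [hp : Fact p.Prime] {M : WeierstrassCurve ℤ_[p]}

/-! ## §1 Equivariance of `Ẽ₁` and `Λ̃` -/

section Maps

variable {K : Type*} [NontriviallyNormedField K] [NormedAlgebra ℚ_[p] K] [IsUltrametricDist K]
  [CompleteSpace K] {K' : Type*} [NontriviallyNormedField K'] [NormedAlgebra ℚ_[p] K']
  [IsUltrametricDist K'] [CompleteSpace K']
  [(curveK p K M).IsIntegral (NormedField.valuation (K := K)).integer]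
  [(curveK p K' M).IsIntegral (NormedField.valuation (K := K')).integer]

omit [CompleteSpace K] [IsUltrametricDist K'] [CompleteSpace K']
  [(curveK p K M).IsIntegral (NormedField.valuation (K := K)).integer]
  [(curveK p K' M).IsIntegral (NormedField.valuation (K := K')).integer] in
/-- `T_φ (n • P) = n • T_φ P`, stated with `n • P` formed in `E(K) = (curveK p K M)`-points (Mathlib's
`map_nsmul`, re-keyed for rewriting in the `curveK` currency). [folklore] -/
theorem map_nsmul_curveK (φ : K →ₐ[ℚ_[p]] K') (n : ℕ) (P : (curveK p K M).toAffine.Point) :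
    Affine.Point.map (W' := (M.map PadicInt.Coe.ringHom).toAffine) φ (n • P) =
      n • Affine.Point.map (W' := (M.map PadicInt.Coe.ringHom).toAffine) φ P :=
  map_nsmul _ n P

omit [CompleteSpace K] [CompleteSpace K'] in
/-- `T_φ (n • P) ∈ E₁(K') ↔ n • P ∈ E₁(K)` for an isometric `φ` (`T_φ (n • P) = n • T_φ P`). [folklore] -/
theorem map_nsmul_mem_kernel_iff (φ : K →ₐ[ℚ_[p]] K') (hφ : ∀ x, ‖φ x‖ = ‖x‖)
    (P : (curveK p K M).toAffine.Point) (n : ℕ) :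
    Affine.Point.map (W' := (M.map PadicInt.Coe.ringHom).toAffine) φ (n • P) ∈
        kernel (NormedField.valuation (K := K')) (curveK p K' M) ↔
      n • P ∈ kernel (NormedField.valuation (K := K)) (curveK p K M) :=
  map_mem_kernel_iff φ hφ (n • P)

omit [CompleteSpace K] [CompleteSpace K'] in
/-- **`T_φ P ∈ Ẽ₁(K') ↔ P ∈ Ẽ₁(K)`** for an isometric `φ`. [folklore] -/
theorem map_mem_satKernel_iff (φ : K →ₐ[ℚ_[p]] K') (hφ : ∀ x, ‖φ x‖ = ‖x‖)
    (P : (curveK p K M).toAffine.Point) :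
    Affine.Point.map (W' := (M.map PadicInt.Coe.ringHom).toAffine) φ P ∈ satKernel p K' M ↔
      P ∈ satKernel p K M := by
  constructor
  · intro hP'
    obtain ⟨n, hn, h⟩ := mem_satKernel_iff.mp hP'
    refine mem_satKernel_of_nsmul_mem hn ((map_nsmul_mem_kernel_iff φ hφ P n).mp ?_)
    rw [map_nsmul_curveK]
    exact h
  · intro hP
    obtain ⟨n, hn, h⟩ := mem_satKernel_iff.mp hP
    have h' : Affine.Point.map (W' := (M.map PadicInt.Coe.ringHom).toAffine) φ (n • P) ∈
        kernel (NormedField.valuation (K := K')) (curveK p K' M) :=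
      (map_nsmul_mem_kernel_iff φ hφ P n).mpr h
    rw [map_nsmul_curveK] at h'
    exact mem_satKernel_of_nsmul_mem hn h'

omit [CompleteSpace K] [CompleteSpace K'] in
/-- A finite sum of conjugates of a point of `Ẽ₁(K)` lies in `Ẽ₁(K')`. [folklore] -/
theorem sum_map_mem_satKernel {ι : Type*} (s : Finset ι) (φ : ι → (K →ₐ[ℚ_[p]] K'))
    (hφ : ∀ i x, ‖φ i x‖ = ‖x‖) {P : (curveK p K M).toAffine.Point} (hP : P ∈ satKernel p K M) :
    (∑ i ∈ s, Affine.Point.map (W' := (M.map PadicInt.Coe.ringHom).toAffine) (φ i) P) ∈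
      satKernel p K' M := by
  induction s using Finset.induction_on with
  | empty =>
    rw [Finset.sum_empty]
    exact (satKernel p K' M).zero_mem
  | insert i s hi ih =>
    rw [Finset.sum_insert hi]
    exact (satKernel p K' M).add_mem ((map_mem_satKernel_iff (φ i) (hφ i) P).mpr hP) ih

variable [(M.map PadicInt.Coe.ringHom).IsElliptic]

/-- **Equivariance of the saturated logarithm: `Λ̃(T_φ P) = φ(Λ̃(P))` for every `P ∈ E(K)`** and every
isometric `ℚ_p`-algebra map `φ : K → K'` (both sides vanish off `Ẽ₁`). [cite: SilvermanAEC2009, IV.6.4 and Prop. VII.2.2] -/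
theorem satLog_map (φ : K →ₐ[ℚ_[p]] K') (hφ : ∀ x, ‖φ x‖ = ‖x‖) (P : (curveK p K M).toAffine.Point) :
    satLog p K' M (Affine.Point.map (W' := (M.map PadicInt.Coe.ringHom).toAffine) φ P) =
      φ (satLog p K M P) := by
  by_cases hP : P ∈ satKernel p K M
  · obtain ⟨n, hn, h⟩ := mem_satKernel_iff.mp hP
    have h' : Affine.Point.map (W' := (M.map PadicInt.Coe.ringHom).toAffine) φ (n • P) ∈
        kernel (NormedField.valuation (K := K')) (curveK p K' M) :=
      (map_nsmul_mem_kernel_iff φ hφ P n).mpr h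
    have e : satLog p K' M (Affine.Point.map (W' := (M.map PadicInt.Coe.ringHom).toAffine) φ P) =
        ptLog p K' M (Affine.Point.map (W' := (M.map PadicInt.Coe.ringHom).toAffine) φ (n • P)) / n := by
      rw [map_nsmul_curveK] at h' ⊢
      exact satLog_eq_div hn h'
    rw [e, satLog_eq_div hn h, map_div₀, map_natCast, ptLog_map φ hφ h]
  · rw [satLog_of_not_mem hP, satLog_of_not_mem (fun h => hP ((map_mem_satKernel_iff φ hφ P).mp h)),
      map_zero]

/-- **`Λ̃(∑ᵢ T_{φᵢ} P) = ∑ᵢ φᵢ (Λ̃ P)`** for `P ∈ Ẽ₁(K)` and isometric `φᵢ : K → K'` — with `φᵢ` running over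
`Gal(K/ℚ₃)` this is `Λ̃(N_{K/ℚ₃} P) = Tr_{K/ℚ₃}(Λ̃ P)`, the identity SAT₀ uses. [cite: SilvermanAEC2009, IV.6.4] -/
theorem satLog_sum_map {ι : Type*} (s : Finset ι) (φ : ι → (K →ₐ[ℚ_[p]] K'))
    (hφ : ∀ i x, ‖φ i x‖ = ‖x‖) {P : (curveK p K M).toAffine.Point} (hP : P ∈ satKernel p K M) :
    satLog p K' M (∑ i ∈ s, Affine.Point.map (W' := (M.map PadicInt.Coe.ringHom).toAffine) (φ i) P) =
      ∑ i ∈ s, φ i (satLog p K M P) := by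
  induction s using Finset.induction_on with
  | empty => rw [Finset.sum_empty, Finset.sum_empty, satLog_zero]
  | insert i s hi ih =>
    rw [Finset.sum_insert hi, Finset.sum_insert hi, ← ih, ← satLog_map (φ i) (hφ i) P]
    exact satLog_add ((map_mem_satKernel_iff (φ i) (hφ i) P).mpr hP) (sum_map_mem_satKernel s φ hφ hP)

end Maps

section Galois

variable {K : Type*} [NontriviallyNormedField K] [NormedAlgebra ℚ_[p] K] [IsUltrametricDist K]
  [CompleteSpace K] [Algebra.IsAlgebraic ℚ_[p] K]
  [(curveK p K M).IsIntegral (NormedField.valuation (K := K)).integer]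

omit [CompleteSpace K] in
/-- `σ P ∈ Ẽ₁(K) ↔ P ∈ Ẽ₁(K)` for `σ ∈ Gal(K/ℚ_p)`, `K/ℚ_p` algebraic. [folklore] -/
theorem galois_mem_satKernel_iff (σ : K ≃ₐ[ℚ_[p]] K) (P : (curveK p K M).toAffine.Point) :
    Affine.Point.map (W' := (M.map PadicInt.Coe.ringHom).toAffine) (σ : K →ₐ[ℚ_[p]] K) P ∈
        satKernel p K M ↔ P ∈ satKernel p K M :=
  map_mem_satKernel_iff (σ : K →ₐ[ℚ_[p]] K) (norm_algEquiv_eq σ) P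

variable [(M.map PadicInt.Coe.ringHom).IsElliptic]

/-- **`Λ̃(σ P) = σ Λ̃(P)` for every `σ ∈ Gal(K/ℚ_p)`**, `K/ℚ_p` algebraic, every `P ∈ E(K)`.
[cite: SilvermanAEC2009, IV.6.4 and Prop. VII.2.2] -/
theorem satLog_galois (σ : K ≃ₐ[ℚ_[p]] K) (P : (curveK p K M).toAffine.Point) :
    satLog p K M (Affine.Point.map (W' := (M.map PadicInt.Coe.ringHom).toAffine)
        (σ : K →ₐ[ℚ_[p]] K) P) = σ (satLog p K M P) :=
  satLog_map (σ : K →ₐ[ℚ_[p]] K) (norm_algEquiv_eq σ) P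

/-- **`Λ̃(∑_σ σP) = ∑_σ σ(Λ̃ P)` over a finite set of Galois automorphisms** (`= Tr_{K/ℚ_p}(Λ̃ P)` when the
set is all of `Gal(K/ℚ_p)` and `K/ℚ_p` is Galois). [cite: SilvermanAEC2009, IV.6.4] -/
theorem satLog_sum_galois (s : Finset (K ≃ₐ[ℚ_[p]] K)) {P : (curveK p K M).toAffine.Point}
    (hP : P ∈ satKernel p K M) :
    satLog p K M (∑ σ ∈ s, Affine.Point.map (W' := (M.map PadicInt.Coe.ringHom).toAffine)
        (σ : K →ₐ[ℚ_[p]] K) P) = ∑ σ ∈ s, σ (satLog p K M P) :=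
  satLog_sum_map s (fun σ : K ≃ₐ[ℚ_[p]] K => (σ : K →ₐ[ℚ_[p]] K)) (fun σ => norm_algEquiv_eq σ) hP

end Galois

/-! ## §2 Restriction to `E(ℚ_p)`: `Λ̃ ∘ ι = padicLog` everywhere -/

section BaseChange

variable {K : Type*} [NontriviallyNormedField K] [NormedAlgebra ℚ_[p] K] [IsUltrametricDist K]

omit [IsUltrametricDist K] in
/-- `ι (n • P) = n • ι P`, stated with `n • P` formed in `E(ℚ_p) = (M ⊗ ℚ_p)`-points. [folklore] -/
theorem map_ofId_nsmul (n : ℕ) (P : (M.map PadicInt.Coe.ringHom).toAffine.Point) :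
    Affine.Point.map (W' := (M.map PadicInt.Coe.ringHom).toAffine) (Algebra.ofId ℚ_[p] K) (n • P) =
      n • Affine.Point.map (W' := (M.map PadicInt.Coe.ringHom).toAffine) (Algebra.ofId ℚ_[p] K) P :=
  map_nsmul _ n P

variable [(M.map PadicInt.Coe.ringHom).IsIntegral ℤ_[p]] [(M.map PadicInt.Coe.ringHom).IsElliptic]
  [(M.map PadicInt.Coe.ringHom).IsIntegral (NormedField.valuation (K := ℚ_[p])).integer]
  [(curveK p K M).IsIntegral (NormedField.valuation (K := K)).integer]

/-- `ι (N • P) ∈ E₁(K)` for `N = [E(ℚ_p) : E⁽²⁾(ℚ_p)]` and every `P ∈ E(ℚ_p)`. [folklore] -/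
theorem index_nsmul_map_ofId_mem_kernel (P : (M.map PadicInt.Coe.ringHom).toAffine.Point) :
    Affine.Point.map (W' := (M.map PadicInt.Coe.ringHom).toAffine) (Algebra.ofId ℚ_[p] K)
        (((M.map PadicInt.Coe.ringHom).formalFiltration 2).index • P) ∈
      kernel (NormedField.valuation (K := K)) (curveK p K M) := by
  have h2 : ((M.map PadicInt.Coe.ringHom).formalFiltration 2).index • P ∈
      (M.map PadicInt.Coe.ringHom).formalFiltration 2 :=
    ((M.map PadicInt.Coe.ringHom).formalFiltration 2).nsmul_index_mem P
  rw [map_ofId_mem_kernel_iff]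
  exact ((M.map PadicInt.Coe.ringHom).mem_formalFiltration_zero_iff).mp
    ((M.map PadicInt.Coe.ringHom).formalFiltration_antitone (Nat.zero_le 2) h2)

/-- **Every `ℚ_p`-point maps into `Ẽ₁(K)`** (`[E(ℚ_p) : E⁽²⁾(ℚ_p)]` is finite). [cite: SilvermanAEC2009, VII.6.3] -/
theorem map_ofId_mem_satKernel (P : (M.map PadicInt.Coe.ringHom).toAffine.Point) :
    Affine.Point.map (W' := (M.map PadicInt.Coe.ringHom).toAffine) (Algebra.ofId ℚ_[p] K) P ∈
      satKernel p K M := by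
  have h : Affine.Point.map (W' := (M.map PadicInt.Coe.ringHom).toAffine) (Algebra.ofId ℚ_[p] K)
        (((M.map PadicInt.Coe.ringHom).formalFiltration 2).index • P) ∈
      kernel (NormedField.valuation (K := K)) (curveK p K M) := index_nsmul_map_ofId_mem_kernel P
  rw [map_ofId_nsmul] at h
  exact mem_satKernel_of_nsmul_mem (Nat.pos_of_ne_zero (index_formalFiltration_two_ne_zero _)) h

variable [CompleteSpace K]

/-- **`Λ̃_K(ι P) = padicLog X P` for EVERY `P ∈ E(ℚ_p)`**: the K-side saturated logarithm restricts on
`ℚ_p`-points to n1011's `ℤ_p`-linear logarithm (`Λ̃(ι P) = Λ(ι(N•P))/N = log_X(z(N•P))/N = padicLog P`,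
`N = [E(ℚ_p) : E⁽²⁾(ℚ_p)]`). [cite: SilvermanAEC2009, IV.6.4 and VII.6.3] -/
theorem satLog_map_ofId (P : (M.map PadicInt.Coe.ringHom).toAffine.Point) :
    satLog p K M (Affine.Point.map (W' := (M.map PadicInt.Coe.ringHom).toAffine) (Algebra.ofId ℚ_[p] K) P) =
      algebraMap ℚ_[p] K (padicLog (M.map PadicInt.Coe.ringHom) P) := by
  haveI : CharZero K := charZero_of_injective_algebraMap (algebraMap ℚ_[p] K).injective
  have hN0 : ((M.map PadicInt.Coe.ringHom).formalFiltration 2).index ≠ 0 :=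
    index_formalFiltration_two_ne_zero _
  have h2 : ((M.map PadicInt.Coe.ringHom).formalFiltration 2).index • P ∈
      (M.map PadicInt.Coe.ringHom).formalFiltration 2 :=
    ((M.map PadicInt.Coe.ringHom).formalFiltration 2).nsmul_index_mem P
  have hK : Affine.Point.map (W' := (M.map PadicInt.Coe.ringHom).toAffine) (Algebra.ofId ℚ_[p] K)
        (((M.map PadicInt.Coe.ringHom).formalFiltration 2).index • P) ∈
      kernel (NormedField.valuation (K := K)) (curveK p K M) :=
    index_nsmul_map_ofId_mem_kernel P
  have e : satLog p K M (Affine.Point.map (W' := (M.map PadicInt.Coe.ringHom).toAffine) (Algebra.ofId ℚ_[p] K) P) =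
      ptLog p K M (Affine.Point.map (W' := (M.map PadicInt.Coe.ringHom).toAffine) (Algebra.ofId ℚ_[p] K)
        (((M.map PadicInt.Coe.ringHom).formalFiltration 2).index • P)) /
        ((M.map PadicInt.Coe.ringHom).formalFiltration 2).index := by
    rw [map_ofId_nsmul] at hK ⊢
    exact satLog_eq_div (Nat.pos_of_ne_zero hN0) hK
  rw [e, ptLog_map_ofId_of_mem_two h2, map_nsmul, nsmul_eq_mul, map_mul, map_natCast,
    mul_div_cancel_left₀ _ (Nat.cast_ne_zero.mpr hN0)]

end BaseChange

end Summit.BirchSwinnertonDyer.BirchSwinnertonDyer.Theorems.KPort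

end
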